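import Summits.NavierStokesRegularity.NavierStokesRegularity.Theorems.OddMorawetzLocal.Negative.OddMorawetzLocalRefutationData3
import Summits.NavierStokesRegularity.NavierStokesRegularity.Theorems.OddMorawetzLocal.Negative.OddMorawetzLocalRefutationDefsV
import HarnessLib

/-!
# Crux `OddMorawetzLocal` (stmt-NavierStokesRegularity-1376) — kernel certificates, weight 3 (part C)

Sequel to parts A/B: the shape-disjointness of the three certificate blocks (`cert3_disjoint`), the index ranges of the
weight-3 certificate data (`cert3_ranges`) and membership of the 40 representatives in the basis (`cert3_reps_mem`) — the
remaining hypotheses of the generic certificate-bridge lemmas. No analysis; lands `--supports` the crux item.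
-/

set_option linter.dupNamespace false

namespace Summit.NavierStokesRegularity.NavierStokesRegularity.Theorems.OddMorawetz

/-- Rows of one weight-3 certificate block never have the shape of a column representative of another block. -/
theorem cert3_disjoint : blockShapesDisjoint 3 reps3 blocks3 = true := by decide +kernel

/-- Index ranges and sizes of the weight-3 certificate data are consistent; there are three blocks. -/
theorem cert3_ranges : certRangesOk 3 reps3 blocks3 kcols3 cinv3 17 = true ∧ blocks3.length = 3 := by
  refine ⟨by decide +kernel, by decide +kernel⟩

/-- Every weight-3 orbit representative is a basis monomial of `idx 3`. -/
theorem cert3_reps_mem : (reps3.all fun m => decide (m ∈ idx 3)) = true := by decide +kernel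

end Summit.NavierStokesRegularity.NavierStokesRegularity.Theorems.OddMorawetz
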